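import Mathlib.NumberTheory.Zsqrtd.GaussianInt
import Literature.Computability.QuantumComplexity.PauliParseval
import Literature.Analysis.ValidatedNumerics.MatrixEigenEnclosure
import HarnessLib

/-!
# Exact sparse-state energies of integer-weighted Pauli Hamiltonians, and the variational certificate

HONEST FRAMING (lane `pub-qadeq`): instance-level adjudication of specific advantage claims; no claim
about BQP vs BPP or the summit. This file is CERTIFICATE INFRASTRUCTURE, not a statement about any
experiment.

What it is for. Sample-based (Krylov) quantum diagonalisation claims — e.g. Kirby et al. (IBM),
arXiv:2603.03496v2 (2026), the Quantum Advantage Tracker's "guided sparse ground state" instance — rest on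
two facts the authors themselves stress: the reported energy is VARIATIONAL ("if the energies from the
quantum algorithm are lower then they must also have lower error") and the sampled configurations are "a
classical witness for the approximate ground state energy … efficiently validated by a third party without a
quantum computer" [cite: KirbyEtAl2026, §I (p. 1)]. The validation is the Rayleigh–Ritz / variational
principle `λ_min(H) ≤ ⟨ψ|H|ψ⟩/⟨ψ|ψ⟩` [cite: KempeEtAl2010, §2 (local Hamiltonian problem: ground energy as
the minimum of ⟨ψ|H|ψ⟩)] applied to a SPARSE `ψ`. This file makes that validation kernel-checkable for
Hamiltonians `H = Σ_t w_t · σ_{S_t}` with INTEGER weights `w_t` on Pauli strings `S_t` (the tree's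
`pauliString`, `PauliExpansion.lean`) and witnesses `ψ = Σ_{(x,a)} a |x⟩` with GAUSSIAN-INTEGER amplitudes
(rational data is brought to this form by clearing denominators, which rescales `H` and leaves the Rayleigh
quotient of `ψ` unchanged):

* `Pauli.zi`, `stringZi` — the entries of `σ_P` and of a Pauli string as Gaussian integers (`∈ {0, ±1, ±i}`),
  with `toComplex` cast lemmas to `Pauli.mat` / `pauliString`;
* `SparseKet ι = List ((ι → Bool) × ℤ[i])`, its dense vector `SparseKet.vec`, the exact bilinear form
  `SparseKet.form E φ ψ = Σ_{(x,a)∈φ} Σ_{(y,b)∈ψ} ā · E x y · b` and the cast theorem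
  `toComplex (form E φ ψ) = (vec φ)† M (vec ψ)` whenever `E` tabulates `M`;
* `normSqZi`, `energyZi`, `intPauliHamiltonian` with `toComplex_normSqZi`, `toComplex_energyZi`,
  `isHermitian_intPauliHamiltonian`;
* the certificate `exists_eigenvalue_le_of_sparse_witness`: if `normSqZi ψ = d` with `0 < d` and
  `energyZi terms ψ = e` (two equalities in `ℤ[i]`, decidable by evaluation), then some eigenvalue of
  `H` is `≤ e/d` — via the tree's `Literature.Analysis.ValidatedNumerics.exists_eigenvalues_le_of_re_form_le`.

All proofs are real; no named facts. The arithmetic is exact (ℤ[i]); nothing here is specific to 49 qubits.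

## References
* [KirbyEtAl2026] W. Kirby et al., Observation of improved accuracy over classical sparse ground-state
  solvers using a quantum computer, arXiv:2603.03496v2 (2026), §I p. 1 (variational energies; classical
  witness), ref. [27] (public 49-qubit instance).
* [KempeEtAl2010] as cited in `PauliExpansion.lean` (Pauli alphabet, Pauli strings, local Hamiltonians).
-/

namespace Literature.Computability.QuantumComplexity

open Matrix GaussianInt

/-! ### Pauli entries as Gaussian integers -/

namespace Pauli

/-- The entries of the one-qubit Pauli matrices as Gaussian integers (`I = 1`, `X`, `Y = [[0,−i],[i,0]]`,
`Z = diag(1,−1)`), mirroring `Pauli.mat`. [cite: KempeEtAl2010, §2] -/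
def zi : Pauli → Bool → Bool → GaussianInt
  | I, a, b => if a = b then 1 else 0
  | X, a, b => if a = b then 0 else 1
  | Y, a, b => if a = b then 0 else if a then ⟨0, 1⟩ else ⟨0, -1⟩
  | Z, a, b => if a = b then (if a then -1 else 1) else 0

/-- `Pauli.zi` casts to `Pauli.mat`. [folklore] -/
theorem toComplex_zi (P : Pauli) (a b : Bool) : ((P.zi a b : GaussianInt) : ℂ) = P.mat a b := by
  cases P <;> cases a <;> cases b <;>
    simp [zi, mat, toComplex_def₂, Complex.ext_iff]

end Pauli

section Strings

variable {ι : Type*} [Fintype ι] [DecidableEq ι]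

/-- The `(x, y)` entry `∏ᵢ (σ_{Sᵢ})_{xᵢ yᵢ} ∈ {0, ±1, ±i}` of a Pauli string, as a Gaussian integer.
[cite: KempeEtAl2010, §2 (𝒫ⁿ)] -/
def stringZi (S : ι → Pauli) (x y : ι → Bool) : GaussianInt :=
  ∏ i, (S i).zi (x i) (y i)

omit [DecidableEq ι] in
/-- `stringZi` casts to the tree's `pauliString`. [folklore] -/
theorem toComplex_stringZi (S : ι → Pauli) (x y : ι → Bool) :
    ((stringZi S x y : GaussianInt) : ℂ) = pauliString S x y := by
  rw [stringZi, pauliString_eq, tensorAll_apply, map_prod]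
  exact Finset.prod_congr rfl fun i _ => Pauli.toComplex_zi (S i) (x i) (y i)

/-! ### Sparse kets with Gaussian-integer amplitudes -/

/-- A sparse ket `Σ_{(x,a)} a |x⟩`: a list of (basis bitstring, Gaussian-integer amplitude) pairs
(repeated bitstrings add up). [cite: KirbyEtAl2026, §I (p. 1, "sparse vector approximation of the ground
state")] -/
abbrev SparseKet (ι : Type*) : Type _ := List ((ι → Bool) × GaussianInt)

namespace SparseKet

/-- The basis-vector summand `a · e_x` as a function on the register. [folklore] -/
def delta (x : ι → Bool) (a : GaussianInt) : (ι → Bool) → ℂ :=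
  fun z => if x = z then (a : ℂ) else 0

/-- The dense vector `Σ_{(x,a) ∈ ψ} a · e_x` of a sparse ket. [folklore] -/
def vec (ψ : SparseKet ι) : (ι → Bool) → ℂ :=
  (ψ.map fun p => delta p.1 p.2).sum

omit [DecidableEq ι] in
/-- `vec [] = 0`. [folklore] -/
@[simp] theorem vec_nil : vec ([] : SparseKet ι) = 0 := by
  simp [vec]

omit [DecidableEq ι] in
/-- `vec ((x,a) :: ψ) = a·e_x + vec ψ`. [folklore] -/
@[simp] theorem vec_cons (p : (ι → Bool) × GaussianInt) (ψ : SparseKet ι) :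
    vec (p :: ψ) = delta p.1 p.2 + vec ψ := by
  simp [vec]

/-- The exact sesquilinear form `Σ_{(x,a)∈φ} Σ_{(y,b)∈ψ} ā · E x y · b ∈ ℤ[i]` of an entry table `E`.
[folklore] -/
def form (E : (ι → Bool) → (ι → Bool) → GaussianInt) (φ ψ : SparseKet ι) : GaussianInt :=
  (φ.map fun p => (ψ.map fun q => star p.2 * E p.1 q.1 * q.2).sum).sum

/-- `M (a e_y) = (z ↦ M z y · a)`. [folklore] -/
theorem mulVec_delta (M : Matrix (ι → Bool) (ι → Bool) ℂ) (y : ι → Bool) (b : GaussianInt) :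
    M *ᵥ delta y b = fun z => M z y * (b : ℂ) := by
  funext z
  simp only [mulVec, dotProduct, delta, mul_ite, mul_zero, Finset.sum_ite_eq, Finset.mem_univ,
    if_true]

/-- `(a e_x)† w = ā · w x`. [folklore] -/
theorem star_delta_dotProduct (x : ι → Bool) (a : GaussianInt) (w : (ι → Bool) → ℂ) :
    star (delta x a) ⬝ᵥ w = star (a : ℂ) * w x := by
  simp only [dotProduct, delta, Pi.star_apply, apply_ite (star : ℂ → ℂ), star_zero, ite_mul,
    zero_mul, Finset.sum_ite_eq, Finset.mem_univ, if_true]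

/-- Base case of the cast theorem: `(a e_x)† M (b e_y) = ā · M x y · b`. [folklore] -/
theorem star_delta_dotProduct_mulVec_delta (M : Matrix (ι → Bool) (ι → Bool) ℂ) (x y : ι → Bool)
    (a b : GaussianInt) :
    star (delta x a) ⬝ᵥ (M *ᵥ delta y b) = star (a : ℂ) * M x y * (b : ℂ) := by
  rw [mulVec_delta, star_delta_dotProduct, mul_assoc]

/-- Inner induction: one bra summand against a whole sparse ket. [folklore] -/
theorem toComplex_inner (E : (ι → Bool) → (ι → Bool) → GaussianInt)
    (M : Matrix (ι → Bool) (ι → Bool) ℂ) (hE : ∀ x y, ((E x y : GaussianInt) : ℂ) = M x y)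
    (p : (ι → Bool) × GaussianInt) (ψ : SparseKet ι) :
    (((ψ.map fun q => star p.2 * E p.1 q.1 * q.2).sum : GaussianInt) : ℂ) =
      star (delta p.1 p.2) ⬝ᵥ (M *ᵥ vec ψ) := by
  induction ψ with
  | nil => simp
  | cons q ψ ih =>
      rw [List.map_cons, List.sum_cons, vec_cons, mulVec_add, dotProduct_add, ← ih,
        map_add, map_mul, map_mul, star_delta_dotProduct_mulVec_delta, ← hE, toComplex_star]
      rfl

/-- **Cast theorem.** If `E` tabulates the matrix `M` entrywise, the exact form is the dense
sesquilinear form: `form E φ ψ = (vec φ)† M (vec ψ)` in `ℂ`. [folklore] -/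
theorem toComplex_form (E : (ι → Bool) → (ι → Bool) → GaussianInt)
    (M : Matrix (ι → Bool) (ι → Bool) ℂ) (hE : ∀ x y, ((E x y : GaussianInt) : ℂ) = M x y)
    (φ ψ : SparseKet ι) :
    ((form E φ ψ : GaussianInt) : ℂ) = star (vec φ) ⬝ᵥ (M *ᵥ vec ψ) := by
  induction φ with
  | nil => simp [form]
  | cons p φ ih =>
      have hform : form E (p :: φ) ψ = (ψ.map fun q => star p.2 * E p.1 q.1 * q.2).sum + form E φ ψ := by
        simp [form]
      rw [hform, vec_cons, star_add, add_dotProduct, ← ih, ← toComplex_inner E M hE p ψ, map_add]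

/-- The exact squared norm `⟨ψ|ψ⟩ ∈ ℤ[i]` (real, see `toComplex_normSqZi`). [folklore] -/
def normSqZi (ψ : SparseKet ι) : GaussianInt :=
  form (fun x y => if x = y then 1 else 0) ψ ψ

/-- `normSqZi ψ` casts to `(vec ψ)† (vec ψ)`. [folklore] -/
theorem toComplex_normSqZi (ψ : SparseKet ι) :
    ((normSqZi ψ : GaussianInt) : ℂ) = star (vec ψ) ⬝ᵥ vec ψ := by
  have h := toComplex_form (fun x y => if x = y then 1 else 0) (1 : Matrix (ι → Bool) (ι → Bool) ℂ)
    (fun x y => by rw [Matrix.one_apply]; split <;> simp) ψ ψ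
  rwa [one_mulVec] at h

end SparseKet

/-! ### Integer-weighted Pauli Hamiltonians and the exact energy -/

/-- `H = Σ_t w_t · σ_{S_t}` for a list of (integer weight, Pauli word) terms, as a `2ⁿ × 2ⁿ` matrix
on the register. [cite: KempeEtAl2010, §2 (k-local Hamiltonians as sums of Pauli terms)] -/
def intPauliHamiltonian (terms : List (ℤ × (ι → Pauli))) : Matrix (ι → Bool) (ι → Bool) ℂ :=
  (terms.map fun t => ((t.1 : ℤ) : ℂ) • pauliString t.2).sum

omit [DecidableEq ι] in
/-- `H_{[]} = 0`. [folklore] -/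
@[simp] theorem intPauliHamiltonian_nil : intPauliHamiltonian ([] : List (ℤ × (ι → Pauli))) = 0 := by
  simp [intPauliHamiltonian]

omit [DecidableEq ι] in
/-- `H_{t :: terms} = w_t σ_{S_t} + H_terms`. [folklore] -/
@[simp] theorem intPauliHamiltonian_cons (t : ℤ × (ι → Pauli)) (terms : List (ℤ × (ι → Pauli))) :
    intPauliHamiltonian (t :: terms) = ((t.1 : ℤ) : ℂ) • pauliString t.2 + intPauliHamiltonian terms := by
  simp [intPauliHamiltonian]

omit [DecidableEq ι] in
/-- `H` is Hermitian (integer weights on Hermitian Pauli strings). [folklore] -/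
theorem isHermitian_intPauliHamiltonian (terms : List (ℤ × (ι → Pauli))) :
    (intPauliHamiltonian terms).IsHermitian := by
  induction terms with
  | nil => rw [intPauliHamiltonian_nil]; exact Matrix.isHermitian_zero
  | cons t terms ih =>
      rw [intPauliHamiltonian_cons]
      refine Matrix.IsHermitian.add ?_ ih
      change Matrix.conjTranspose _ = _
      rw [Matrix.conjTranspose_smul, conjTranspose_pauliString, Complex.star_def, map_intCast]

/-- The exact energy numerator `⟨ψ|H|ψ⟩ = Σ_t w_t · form (σ_{S_t}) ψ ψ ∈ ℤ[i]`.
[cite: KirbyEtAl2026, §I (p. 1, "the output energy is the energy of this sparse vector")] -/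
def energyZi (terms : List (ℤ × (ι → Pauli))) (ψ : SparseKet ι) : GaussianInt :=
  (terms.map fun t => (t.1 : GaussianInt) * SparseKet.form (stringZi t.2) ψ ψ).sum

/-- `energyZi` casts to `(vec ψ)† H (vec ψ)`. [folklore] -/
theorem toComplex_energyZi (terms : List (ℤ × (ι → Pauli))) (ψ : SparseKet ι) :
    ((energyZi terms ψ : GaussianInt) : ℂ) =
      star (SparseKet.vec ψ) ⬝ᵥ (intPauliHamiltonian terms *ᵥ SparseKet.vec ψ) := by
  induction terms with
  | nil => simp [energyZi]
  | cons t terms ih =>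
      have h : energyZi (t :: terms) ψ =
          (t.1 : GaussianInt) * SparseKet.form (stringZi t.2) ψ ψ + energyZi terms ψ := by
        simp [energyZi]
      rw [h, intPauliHamiltonian_cons, add_mulVec, dotProduct_add, smul_mulVec, dotProduct_smul,
        ← ih, ← SparseKet.toComplex_form (stringZi t.2) (pauliString t.2) (toComplex_stringZi t.2) ψ ψ,
        map_add, map_mul, map_intCast, smul_eq_mul]

/-! ### The variational certificate -/

/-- `(vec ψ)† (vec ψ) = Σ_x ‖(vec ψ) x‖²` as a complex number. [folklore] -/
theorem star_dotProduct_self_eq_sum_norm_sq (v : (ι → Bool) → ℂ) :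
    star v ⬝ᵥ v = ((∑ x, ‖v x‖ ^ 2 : ℝ) : ℂ) := by
  simp only [dotProduct, Pi.star_apply, Complex.star_def, Complex.ofReal_sum, Complex.ofReal_pow]
  refine Finset.sum_congr rfl fun x _ => ?_
  rw [Complex.conj_mul']

/-- **Sparse-witness certificate (variational principle, exact arithmetic).** Let `H = Σ_t w_t σ_{S_t}`
have integer weights and let `ψ` be a sparse ket with Gaussian-integer amplitudes. If the two evaluations
`normSqZi ψ = d` (with `0 < d`) and `energyZi terms ψ = e` hold in `ℤ[i]` — both decidable by
computation — then some eigenvalue of `H` is at most `e / d`; in particular the ground energy is.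
[cite: KirbyEtAl2026, §I (p. 1: variational energies + classical witness)]
[cite: KempeEtAl2010, §2] -/
theorem exists_eigenvalue_le_of_sparse_witness (terms : List (ℤ × (ι → Pauli))) (ψ : SparseKet ι)
    {d : ℕ} {e : ℤ} (hd : 0 < d) (hnorm : SparseKet.normSqZi ψ = (d : GaussianInt))
    (henergy : energyZi terms ψ = (e : GaussianInt)) :
    ∃ i, (isHermitian_intPauliHamiltonian terms).eigenvalues i ≤ (e : ℝ) / d := by
  set v := SparseKet.vec ψ with hv
  have hnormC : star v ⬝ᵥ v = ((d : ℝ) : ℂ) := by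
    rw [hv, ← SparseKet.toComplex_normSqZi, hnorm, map_natCast]
    norm_cast
  have hsum : ∑ x, ‖v x‖ ^ 2 = (d : ℝ) := by
    have := star_dotProduct_self_eq_sum_norm_sq v
    rw [hnormC] at this
    exact_mod_cast this.symm
  have hpos : 0 < ∑ x, ‖v x‖ ^ 2 := by rw [hsum]; exact_mod_cast hd
  have henergyC : star v ⬝ᵥ (intPauliHamiltonian terms *ᵥ v) = ((e : ℝ) : ℂ) := by
    rw [hv, ← toComplex_energyZi, henergy, map_intCast]
    norm_cast
  refine Literature.Analysis.ValidatedNumerics.exists_eigenvalues_le_of_re_form_le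
    (isHermitian_intPauliHamiltonian terms) hpos ?_
  rw [henergyC, hsum, RCLike.re_to_complex, Complex.ofReal_re]
  have hd' : (0 : ℝ) < d := by exact_mod_cast hd
  rw [div_mul_cancel₀ _ hd'.ne']

/-! ### Toy kernel evaluation (the certificate equalities are computations in `ℤ[i]`) -/

/-- The two-qubit Hamiltonian `H = −Z₀Z₁ − X₀X₁` (terms as (weight, word)). [folklore] -/
def toyTerms : List (ℤ × (Fin 2 → Pauli)) :=
  [(-1, ![Pauli.Z, Pauli.Z]), (-1, ![Pauli.X, Pauli.X])]

/-- The Bell-type witness `|00⟩ + |11⟩`. [folklore] -/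
def toyKet : SparseKet (Fin 2) :=
  [(![false, false], 1), (![true, true], 1)]

/-- `⟨ψ|ψ⟩ = 2`. [folklore] -/
theorem normSqZi_toyKet : SparseKet.normSqZi toyKet = (2 : ℕ) := by decide

/-- `⟨ψ|H|ψ⟩ = −4`. [folklore] -/
theorem energyZi_toy : energyZi toyTerms toyKet = ((-4 : ℤ) : GaussianInt) := by decide

/-- Hence some eigenvalue of `−Z₀Z₁ − X₀X₁` is `≤ −4/2 = −2` (indeed its ground energy). [folklore] -/
theorem toy_certificate : ∃ i, (isHermitian_intPauliHamiltonian toyTerms).eigenvalues i ≤ (-4 : ℤ) / (2 : ℕ) :=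
  exists_eigenvalue_le_of_sparse_witness toyTerms toyKet (by norm_num) normSqZi_toyKet energyZi_toy

end Strings

end Literature.Computability.QuantumComplexity
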